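import Summits.MatrixMultiplication.MatrixMultiplication.Theses.FarEdgeDescent
import Summits.MatrixMultiplication.MatrixMultiplication.Theorems.LittleCwFarEdgeBound

/-!
# FarEdgeDescent — little-CW TRANSFER of the pencil leaves (ω-free dictionary)

Route `route-MatrixMultiplication-FarEdgeDescent` (lens 2, structural dichotomy).  The landed helper chain
`Theorems.LittleCwFarEdgeBoundData → …Layers → Theorems.LittleCwFarEdgeBound` proves, unconditionally, the
little-CW far-edge certificate and the sweet-spot dictionary
`excess_le_of_littleCwDeficiency : R̃(cw_{k+1}) ≤ k+2+η ⟹ e(k) = ω(1,k,1) − (k+1) ≤ η / log(k+1)`.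
This module turns the dictionary into the ω-FREE TRANSFERS of the route's pencil-axis leaves to the asymptotic
rank deficiency `η_q := R̃(cw_q) − (q+1)` of ONE explicit tensor family (little Coppersmith–Winograd `cw_q`):

* `finiteSaturation_of_littleCwMinimal`      : `(∃ k ≥ 2, R̃(cw_{k+1}) ≤ k+2)`              → `FiniteSaturation`  (stmt-…-23739);
* `powerAmortisation_of_littleCwDeficiencyDecay` : `(∃ γ>0 C, ∀ q ≥ 2, η_q ≤ C q^{−γ})`     → `PowerAmortisation` (stmt-…-25347);
* `subLogRate_of_littleCwDeficiencyVanishing` : `(η_q → 0)`                                  → `SubLogRate`        (aside stmt-…-25371);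
* (cross-route, separate module `Theorems.OctaveBudgetLittleCwTransfer`: `(∃ C, ∀ q ≥ 2, η_q ≤ C log q / q)` →
  `OctaveBudget.LinearExcessDecay`, stmt-…-25355, lens 5).

Item-level edges (route file rev 7, the two ω-free ASIDES): `finiteSaturation_of_littleCwFlat : LittleCwFlat →
FiniteSaturation` (stmt-…-30671 ⟹ 23739), `powerAmortisation_of_littleCwDeficiencyDecay' : LittleCwDeficiencyDecay →
PowerAmortisation` (stmt-…-30672 ⟹ 25347), `littleCwDeficiencyDecay_of_flat_family`.  When such an aside is also
NECESSARY for `ω = 2` is decided by `Theorems.FarEdgeDescentMMCheap` (MM-cost certificates).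

The hypotheses are statements about `asymptoticRank (cwTensor ℂ q)` only — no `ω`, no `omegaRect`.  Known range:
`q+1 ≤ R̃(cw_q) ≤ bR(cw_q) = q+2` (flattening / border rank), i.e. `0 ≤ η_q ≤ 1`; the transfers ask for `η_q → 0` at a rate.
Barrier status: at `η_q = 0` the CLLZ/CVZ host barrier for `cw_q` is exactly tight at `k+1` (the certificate's value), so none
of these transfers is excluded by a catalogued barrier; what is missing is a construction (Kronecker powers of `cw_q` of rank
`(q+1)^{N+o(N)}`; CGLV: no saving at powers 2, 3).  Support module (`--supports stmt-MatrixMultiplication-25347`); it closes no item.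
-/

noncomputable section

namespace Summit.MatrixMultiplication.MatrixMultiplication.Theorems.LittleCwFarEdgeBound

set_option linter.dupNamespace false

open Literature.Computability.AlgebraicComplexity
section Transfer

open Summit.MatrixMultiplication.MatrixMultiplication.Theses.FarEdgeDescent
  (FiniteSaturation PowerAmortisation SubLogRate LittleCwFlat LittleCwDeficiencyDecay)

/-- Dictionary (i) → the route's `FiniteSaturation` (stmt-…-23739): minimality `R̃(cw_{k+1}) ≤ k+2` of ONE little
CW tensor with `k ≥ 2` gives `e(k) = 0`. -/
theorem finiteSaturation_of_littleCwMinimal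
    (h : ∃ k : ℕ, 2 ≤ k ∧ asymptoticRank (cwTensor ℂ (k + 1)) ≤ (k : ℝ) + 2) : FiniteSaturation := by
  obtain ⟨k, hk, hr⟩ := h
  refine ⟨k, hk, ?_⟩
  have h1 := excess_le_of_littleCwDeficiency (show 1 ≤ k by omega) le_rfl
    (show asymptoticRank (cwTensor ℂ (k + 1)) ≤ (k : ℝ) + 2 + 0 by simpa using hr)
  rw [zero_div] at h1
  -- `e(k) ≥ 0` (information bound `ω(1,k,1) ≥ max(2, k+1)`; cf. `FarEdgeDescentGlue.excess_nonneg`)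
  have h2 : (k : ℝ) + 1 ≤ omegaRect ℂ 1 (k : ℝ) 1 :=
    le_trans (le_max_right _ _) (max_two_add_one_le_omegaRect_one_mid_one ℂ (k : ℝ))
  linarith

/-- Dictionary (ii) → the route's `PowerAmortisation` (stmt-…-25347): power decay of the little-CW deficiency,
`R̃(cw_q) ≤ q + 1 + C·q^{−γ}` (`γ > 0`), gives `e(k) ≤ C'·k^{−γ}`. -/
theorem powerAmortisation_of_littleCwDeficiencyDecay
    (h : ∃ γ C : ℝ, 0 < γ ∧ ∀ q : ℕ, 2 ≤ q →
      asymptoticRank (cwTensor ℂ q) ≤ (q : ℝ) + 1 + C * (q : ℝ) ^ (-γ)) : PowerAmortisation := by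
  obtain ⟨γ, C, hγ, hdec⟩ := h
  have hl2 : 0 < Real.log 2 := Real.log_pos (by norm_num)
  refine ⟨γ, max C 0 / Real.log 2, hγ, fun k hk => ?_⟩
  have hkpos : (0 : ℝ) < k := by exact_mod_cast (show 0 < k by omega)
  have hk1 : (1 : ℝ) ≤ k := by exact_mod_cast hk
  have hpow_nonneg : 0 ≤ ((k : ℝ) + 1) ^ (-γ) := Real.rpow_nonneg (by linarith) _
  have hη0 : 0 ≤ max C 0 * ((k : ℝ) + 1) ^ (-γ) := mul_nonneg (le_max_right _ _) hpow_nonneg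
  have hr : asymptoticRank (cwTensor ℂ (k + 1)) ≤ (k : ℝ) + 2 + max C 0 * ((k : ℝ) + 1) ^ (-γ) := by
    have h0 := hdec (k + 1) (by omega)
    push_cast at h0
    have hC : C * ((k : ℝ) + 1) ^ (-γ) ≤ max C 0 * ((k : ℝ) + 1) ^ (-γ) :=
      mul_le_mul_of_nonneg_right (le_max_left _ _) hpow_nonneg
    linarith
  have h1 := excess_le_of_littleCwDeficiency hk hη0 hr
  have hlogk : Real.log 2 ≤ Real.log ((k : ℝ) + 1) := Real.log_le_log (by norm_num) (by linarith)
  have h2 : max C 0 * ((k : ℝ) + 1) ^ (-γ) / Real.log ((k : ℝ) + 1) ≤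
      max C 0 * ((k : ℝ) + 1) ^ (-γ) / Real.log 2 :=
    div_le_div_of_nonneg_left hη0 hl2 hlogk
  have h3 : ((k : ℝ) + 1) ^ (-γ) ≤ (k : ℝ) ^ (-γ) :=
    Real.rpow_le_rpow_of_nonpos hkpos (by linarith) (by linarith)
  have h4 : max C 0 * ((k : ℝ) + 1) ^ (-γ) / Real.log 2 ≤ max C 0 / Real.log 2 * (k : ℝ) ^ (-γ) := by
    rw [mul_div_right_comm]
    exact mul_le_mul_of_nonneg_left h3 (div_nonneg (le_max_right _ _) hl2.le)
  linarith

/-- Dictionary (iii) → the route's aside `SubLogRate` (stmt-…-25371): a vanishing deficiency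
`R̃(cw_q) − (q+1) → 0` gives `e(k)·log k → 0`. -/
theorem subLogRate_of_littleCwDeficiencyVanishing
    (h : ∀ ε : ℝ, 0 < ε → ∃ q₀ : ℕ, ∀ q : ℕ, q₀ ≤ q → asymptoticRank (cwTensor ℂ q) ≤ (q : ℝ) + 1 + ε) :
    SubLogRate := by
  intro c hc
  obtain ⟨q₀, hq₀⟩ := h (c / 2) (half_pos hc)
  refine ⟨max q₀ 2, le_max_right _ _, fun k hk => ?_⟩
  have hk2 : 2 ≤ k := le_trans (le_max_right _ _) hk
  have hkq : q₀ ≤ k + 1 := le_trans (le_max_left _ _) (le_trans hk (Nat.le_succ k))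
  have hr : asymptoticRank (cwTensor ℂ (k + 1)) ≤ (k : ℝ) + 2 + c / 2 := by
    have h0 := hq₀ (k + 1) hkq
    push_cast at h0
    linarith
  have h1 := excess_le_of_littleCwDeficiency (show 1 ≤ k by omega) (half_pos hc).le hr
  have hk2' : (2 : ℝ) ≤ k := by exact_mod_cast hk2
  have hlogk : 0 < Real.log (k : ℝ) := Real.log_pos (by linarith)
  have hlogle : Real.log (k : ℝ) ≤ Real.log ((k : ℝ) + 1) :=
    Real.log_le_log (by linarith) (by linarith)
  have h2 : c / 2 / Real.log ((k : ℝ) + 1) ≤ c / 2 / Real.log (k : ℝ) :=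
    div_le_div_of_nonneg_left (half_pos hc).le hlogk hlogle
  have h3 : c / 2 / Real.log (k : ℝ) ≤ c / Real.log (k : ℝ) :=
    div_le_div_of_nonneg_right (by linarith) hlogk.le
  linarith

/-! ## Item-level edges (route file rev 7): the ω-free asides imply the pencil leaves -/

/-- **EDGE** aside `LittleCwFlat` (stmt-…-30671) → special leaf `FiniteSaturation` (stmt-…-23739). -/
theorem finiteSaturation_of_littleCwFlat (h : LittleCwFlat) : FiniteSaturation := by
  unfold LittleCwFlat at h
  exact finiteSaturation_of_littleCwMinimal h

/-- **EDGE** aside `LittleCwDeficiencyDecay` (stmt-…-30672) → converting child `PowerAmortisation` (stmt-…-25347). -/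
theorem powerAmortisation_of_littleCwDeficiencyDecay' (h : LittleCwDeficiencyDecay) : PowerAmortisation := by
  unfold LittleCwDeficiencyDecay at h
  exact powerAmortisation_of_littleCwDeficiencyDecay h

/-- `LittleCwFlat` at every `q ≥ 3` (flatness of the whole little-CW family beyond `cw₂`) implies the deficiency
decay with `C = 0` — the two asides are the `η = 0` / `η = O(q^{−γ})` rungs of one ladder. -/
theorem littleCwDeficiencyDecay_of_flat_family
    (h : ∀ q : ℕ, 2 ≤ q → asymptoticRank (cwTensor ℂ q) ≤ (q : ℝ) + 1) : LittleCwDeficiencyDecay := by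
  refine ⟨1, 0, one_pos, fun q hq => ?_⟩
  have h0 := h q hq
  simpa using h0

end Transfer


end Summit.MatrixMultiplication.MatrixMultiplication.Theorems.LittleCwFarEdgeBound

end
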